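import Literature.Geometry.Lorentzian.CauchyProblemCauchy
import HarnessLib

/-!
# The one-jet of an embedding of developments along the data hypersurface is determined by the
# data (Sbierski 2016, §3.1, proof of Cor. 3.2 / arXiv Cor. 8), and MGHD uniqueness reduced to
# O'Neill's one-jet rigidity of local isometries

Companion of `CauchyDevelopment`, `CauchyProblemCauchy` (uniqueness of the maximal vacuum Cauchy
development *given rigidity* of the first development, `VacuumCauchyDevelopment.isIsometricTo_of_isMaximal`)
and `CauchyDevelopmentIsometryClasses`. The rigidity hypothesis there — every time-orientation
preserving isometric immersion `φ : M → M` with `φ ∘ ι = ι` is the identity — is, in the printed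
proofs, obtained in two steps (Choquet-Bruhat–Geroch 1969, proof of Thm. 3, p. 332; Sbierski 2016,
§3.1, the corollary "ψ₁ and ψ₂ agree on U₁ ∩ U₂" to the lemma "isometric immersions with the same
1-jet at a point of a connected manifold agree"):

1. **(one-jet on the hypersurface, proved here)** "Since `ψ₁` and `ψ₂` agree on `Σ`, their
   differentials agree on `Σ` if evaluated on vectors tangent to `Σ`. Moreover, since the isometric
   immersions preserve the time orientation, they both map the future normal of `Σ` onto the future
   normal of `ψ₁(Σ) = ψ₂(Σ)`. Thus, the differentials of `ψ₁` and `ψ₂` agree on `Σ`."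
   (Sbierski 2016, proof of the corollary in §3.1.) This is pointwise Lorentzian linear algebra plus
   the chain rule, and is formalized below in full generality for data embeddings
   (`DataEmbedding`, any dimension `n + 1`):
   * `PseudoRiemannianMetric.exists_eq_add_smul_of_normal` — in a tangent space of dimension
     `dim F + 1`, a non-null vector `ν` normal to the image of an injective `J : F → T_q M` splits
     every vector as `J v + a ν` (`ν^⊥ = im J` by a dimension count);
   * `TimeOrientation.eq_of_isFutureUnitNormal` — **the future unit normal of a spacelike
     hyperplane is unique** (O'Neill 1983, Ch. 5, Lemma 5.26 and p. 145);
   * `DataEmbedding.mfderiv_embed_injective`, `DataEmbedding.mfderiv_comp_embed_apply`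
     (`dψ ∘ dι₁ = dι₂` from `ψ ∘ ι₁ = ι₂`), `DataEmbedding.mfderiv_normal` (`dψ ν₁ = ν₂`),
     `DataEmbedding.exists_eq_mfderiv_embed_add_smul_normal` (`T_{ι x} M = dι(T_x X) ⊕ ℝ ν`);
   * `DataEmbedding.mfderiv_eq_mfderiv_of_comp_embed_eq` — **two time-orientation preserving
     isometric immersions `ψ, ψ' : M₁ → M₂` with `ψ ∘ ι₁ = ψ' ∘ ι₁ = ι₂` have the same differential
     at every point of `ι₁(X)`** (Sbierski's displayed sentence), and its self-map case
     `DataEmbedding.mfderiv_apply_eq_self_of_comp_embed_eq` (`φ ∘ ι = ι` forces `dφ = id` on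
     `T_{ι x} M`).
2. **(one-jet rigidity, O'Neill 1983, Ch. 3, Prop. 3.62; Sbierski 2016, §3.1, first lemma)** an
   isometric immersion of a connected semi-Riemannian manifold into an equidimensional one is
   determined by its value and differential at one point ("`φ ∘ exp_p = exp_{φ p} ∘ dφ_p`" and an
   open–closed argument). Its carrier (the exponential map of the Koszul connection as a local
   diffeomorphism, and geodesics under isometric immersions) is not yet in the tree; it enters
   below as the hypothesis `hjet`, a statement about the spacetime `(M, g)` ALONE (no data, no
   time orientation), strictly weaker and more standard than the rigidity hypothesis `hrig` of
   `CauchyProblemCauchy`: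
   * `DataEmbedding.eq_id_of_comp_embed_eq` — rigidity of a data embedding from one-jet rigidity
     of its spacetime (step 1 supplies the fixed point `ι x` and `dφ_{ι x} = id`);
   * `VacuumCauchyDevelopment.isIsometricTo_of_isMaximal_of_oneJet` — **any two maximal vacuum
     Cauchy developments of the same data are isometric, given one-jet rigidity of local
     isometries of the first** (Choquet-Bruhat–Geroch 1969, Thm. 3, uniqueness clause; Ringström
     2009, Thm. 16.6; Sbierski 2016, Theorem "Existence of MGHD": "unique up to isometry").

No named fact is introduced (D-0026); `hjet` is a hypothesis of two theorems, displayed, never a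
`def`. Nothing else is assumed: the standing Levi-Civita hypotheses play no role here.

## References

* J. Sbierski, *On the existence of a maximal Cauchy development for the Einstein equations: a
  dezornification*, Ann. Henri Poincaré 17 (2016) 301–329 = arXiv:1309.7591, §3.1 (first lemma
  and its corollary), §2 (Theorem "Existence of MGHD").
* Y. Choquet-Bruhat, R. Geroch, *Global aspects of the Cauchy problem in general relativity*,
  Comm. Math. Phys. 14 (1969) 329–335, Thm. 3 and its proof (pp. 332–334).
* B. O'Neill, *Semi-Riemannian geometry with applications to relativity*, Academic Press 1983,
  Ch. 3, Prop. 3.62 (local isometries are determined by their 1-jet at a point); Ch. 5,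
  Lemma 5.26 (a timelike vector has spacelike orthogonal complement) and p. 145 (timecones).
* H. Ringström, *The Cauchy Problem in General Relativity*, EMS 2009, Thm. 16.6.
-/

noncomputable section

open Function Set Module
open scoped Manifold ContDiff Topology

namespace Literature.Geometry.Lorentzian

universe u

/-! ### Pointwise Lorentzian linear algebra: normals to a hyperplane -/

section Generic

variable {E : Type*} [NormedAddCommGroup E] [NormedSpace ℝ E] {H : Type*} [TopologicalSpace H]
  {I : ModelWithCorners ℝ E H} {n : ℕ∞ω} {M : Type*} [TopologicalSpace M] [ChartedSpace H M]
  [IsManifold I ∞ M]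
  {F : Type*} [TopologicalSpace F] [AddCommGroup F] [Module ℝ F]

namespace PseudoRiemannianMetric

variable [FiniteDimensional ℝ E] (g : PseudoRiemannianMetric I n E (TangentSpace I : M → Type _))

/-- **Splitting off a non-null normal.** Let `J : F → T_q M` be an injective linear map from a
space of dimension `dim M - 1`, and `ν ∈ T_q M` a non-null vector (`g(ν, ν) ≠ 0`) normal to the
image of `J`. Then every `w ∈ T_q M` is `J v + (g(ν, w)/g(ν, ν)) ν` for some `v`: indeed
`w - (g(ν, w)/g(ν, ν)) ν ∈ ν^⊥`, and `ν^⊥ = im J` since `im J ⊆ ν^⊥` and both have dimension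
`dim M - 1` (`ν^⊥` is the kernel of the nonzero functional `g(ν, ·)`). O'Neill 1983, Ch. 2,
Lemma 2.23 (`V = W ⊕ W^⊥` for nondegenerate `W`), here for the line `W = ℝ ν`.
[cite: ONeillSemiRiemannian1983, Ch. 2, Lemma 2.23] -/
theorem exists_eq_add_smul_of_normal {q : M} (J : F →L[ℝ] TangentSpace I q)
    (hJ : Function.Injective J) (hdim : finrank ℝ F + 1 = finrank ℝ E) {ν : TangentSpace I q}
    (hνJ : ∀ v, g.val q ν (J v) = 0) (hνν : g.val q ν ν ≠ 0) (w : TangentSpace I q) :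
    ∃ v : F, w = J v + (g.val q ν w / g.val q ν ν) • ν := by
  haveI : FiniteDimensional ℝ (TangentSpace I q) := inferInstanceAs (FiniteDimensional ℝ E)
  -- the hyperplane `ν^⊥ = ker g(ν, ·)` is the image of `J`, by a dimension count
  have hH : LinearMap.range (J : F →ₗ[ℝ] TangentSpace I q) =
      LinearMap.ker ((g.val q ν : TangentSpace I q →L[ℝ] ℝ) : TangentSpace I q →ₗ[ℝ] ℝ) := by
    apply Submodule.eq_of_le_of_finrank_eq
    · rintro _ ⟨v, rfl⟩
      exact LinearMap.mem_ker.mpr (hνJ v)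
    · have h1 : finrank ℝ (LinearMap.range (J : F →ₗ[ℝ] TangentSpace I q)) = finrank ℝ F :=
        LinearMap.finrank_range_of_inj (by simpa using hJ)
      have hsurj : Function.Surjective
          ((g.val q ν : TangentSpace I q →L[ℝ] ℝ) : TangentSpace I q →ₗ[ℝ] ℝ) := fun r ↦
        ⟨(r / g.val q ν ν) • ν, by simp [div_mul_cancel₀ r hνν]⟩
      have h2 : finrank ℝ (LinearMap.range
          ((g.val q ν : TangentSpace I q →L[ℝ] ℝ) : TangentSpace I q →ₗ[ℝ] ℝ)) = 1 := by
        rw [LinearMap.range_eq_top.mpr hsurj, finrank_top, Module.finrank_self]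
      have h3 := LinearMap.finrank_range_add_finrank_ker
        ((g.val q ν : TangentSpace I q →L[ℝ] ℝ) : TangentSpace I q →ₗ[ℝ] ℝ)
      have hE : finrank ℝ (TangentSpace I q) = finrank ℝ E := rfl
      omega
  -- split `w` along `ν`
  have hmem : w - (g.val q ν w / g.val q ν ν) • ν ∈
      LinearMap.ker ((g.val q ν : TangentSpace I q →L[ℝ] ℝ) : TangentSpace I q →ₗ[ℝ] ℝ) := by
    rw [LinearMap.mem_ker]
    simp [div_mul_cancel₀ _ hνν]
  rw [← hH] at hmem
  obtain ⟨v, hv⟩ := hmem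
  refine ⟨v, ?_⟩
  rw [show (J v : TangentSpace I q) = (J : F →ₗ[ℝ] TangentSpace I q) v from rfl, hv]
  abel

end PseudoRiemannianMetric

namespace TimeOrientation

variable [FiniteDimensional ℝ E] {g : LorentzianMetric I n M} (τ : TimeOrientation g)

/-- **The future unit normal of a spacelike hyperplane is unique.** Let `J : F → T_q M` be linear
with `g` positive definite on its image (so `J` is injective) and `dim F = dim M - 1`. If `ν` and
`u` are both future-directed, of square `-1` and normal to the image of `J`, then `u = ν`:
`u = J v₀ + a ν` (`PseudoRiemannianMetric.exists_eq_add_smul_of_normal`), `J v₀` is then normal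
to the whole image of `J` and hence zero (the image is spacelike), so `u = a ν` with `a² = 1`, and
`a = -1` is excluded because `-ν` is past-directed. The point of `u` may be given as `q'` with a
proof `q = q'` (dependent elimination for points produced by the chain rule). O'Neill 1983, Ch. 5,
Lemma 5.26 (a timelike vector has spacelike orthogonal complement) and p. 145 (future/past
cones). [cite: ONeillSemiRiemannian1983, Ch. 5, Lemma 5.26 and p. 145] -/
theorem eq_of_isFutureUnitNormal {q q' : M} (hq : q = q') (J : F →L[ℝ] TangentSpace I q)
    (hJpos : ∀ v, v ≠ 0 → 0 < g.val q (J v) (J v)) (hdim : finrank ℝ F + 1 = finrank ℝ E)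
    {ν : TangentSpace I q} {u : TangentSpace I q'}
    (hνJ : ∀ v, g.val q ν (J v) = 0) (hνν : g.val q ν ν = -1) (hν : τ.IsFutureDirected ν)
    (huJ : ∀ v, g.val q' u (J v) = 0) (huu : g.val q' u u = -1) (hu : τ.IsFutureDirected u) :
    u = ν := by
  subst hq
  -- `J` is injective since its image is spacelike
  have hJ : Function.Injective J := fun v₁ v₂ h ↦ by
    by_contra hne
    have hpos := hJpos (v₁ - v₂) (sub_ne_zero.mpr hne)
    rw [map_sub, h, sub_self, map_zero] at hpos
    simp at hpos
  have hνν' : g.val q ν ν ≠ 0 := by rw [hνν]; norm_num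
  -- split `u = J v₀ + a ν`
  obtain ⟨v₀, hu₀⟩ :=
    g.toPseudoRiemannianMetric.exists_eq_add_smul_of_normal J hJ hdim hνJ hνν' u
  set a : ℝ := g.val q ν u / g.val q ν ν with ha
  have hJv₀ : J v₀ = u - a • ν := eq_sub_of_add_eq hu₀.symm
  -- `J v₀` is normal to the (spacelike) image of `J`, hence zero
  have key : ∀ v, g.val q (J v₀) (J v) = 0 := fun v ↦ by
    simp [hJv₀, huJ v, hνJ v]
  have hv₀ : v₀ = 0 := by
    by_contra hne
    have h := hJpos v₀ hne
    rw [key v₀] at h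
    exact lt_irrefl _ h
  have hu' : u = a • ν := by rw [hu₀, hv₀, map_zero, zero_add]
  -- `a² = 1`, and `a = -1` contradicts the time orientation
  have hsq : g.val q (a • ν) (a • ν) = a * a * g.val q ν ν := by
    simp only [map_smul, smul_eq_mul, FunLike.coe_smul, Pi.smul_apply]
    ring
  have haa : a * a = 1 := by
    have h := huu
    rw [hu', hsq, hνν] at h
    linarith
  rcases mul_self_eq_one_iff.mp haa with h1 | h1
  · rw [hu', h1, one_smul]
  · exfalso
    rw [hu', h1, neg_one_smul] at hu
    exact τ.not_isPastDirected_of_isFutureDirected hν ((τ.isFutureDirected_neg_iff ν).mp hu)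

end TimeOrientation

end Generic

/-! ### The one-jet of an embedding of data embeddings along the data hypersurface -/

section DataEmbedding

variable {n : ℕ} {X' : Type u} [TopologicalSpace X'] [ChartedSpace (EuclideanSpace ℝ (Fin n)) X']
  [IsManifold (𝓡 n) ∞ X'] [ConnectedSpace X'] {D : InitialDataSet (𝓡 n) X'}

namespace DataEmbedding

/-- `g(dι v, dι w) = h(v, w)`: the induced metric clause of a data embedding, evaluated
(`induced_h` with `pullbackBilin_apply`). Ringström 2009, Def. 16.2; Choquet-Bruhat–Geroch 1969,
p. 330. [cite: Ringstrom2009, Def. 16.2] -/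
theorem val_mfderiv_embed (𝒮 : DataEmbedding D) (x : X') (v w : TangentSpace (𝓡 n) x) :
    𝒮.metric.val (𝒮.embed x) (mfderiv (𝓡 n) (𝓡 (n + 1)) 𝒮.embed x v)
      (mfderiv (𝓡 n) (𝓡 (n + 1)) 𝒮.embed x w) = D.h.inner x v w := by
  have h := congrArg (fun b ↦ b v w) (𝒮.induced_h x)
  simpa only [pullbackBilin_apply] using h

/-- The differential of the data embedding is positive definite for `g` (`ι^* g = h` with `h`
Riemannian): `0 < g(dι v, dι v)` for `v ≠ 0`. Ringström 2009, Def. 16.2.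
[cite: Ringstrom2009, Def. 16.2] -/
theorem val_mfderiv_embed_pos (𝒮 : DataEmbedding D) (x : X') {v : TangentSpace (𝓡 n) x}
    (hv : v ≠ 0) :
    0 < 𝒮.metric.val (𝒮.embed x) (mfderiv (𝓡 n) (𝓡 (n + 1)) 𝒮.embed x v)
      (mfderiv (𝓡 n) (𝓡 (n + 1)) 𝒮.embed x v) := by
  rw [val_mfderiv_embed]
  exact D.h.pos x v hv

/-- **The differential of the data embedding is injective** (the induced metric is Riemannian:
`dι v = 0` gives `h(v, v) = g(dι v, dι v) = 0`, so `v = 0`). Choquet-Bruhat–Geroch 1969, p. 330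
(`Σ` is embedded as a spacelike hypersurface); Ringström 2009, Def. 16.2.
[cite: Ringstrom2009, Def. 16.2] -/
theorem mfderiv_embed_injective (𝒮 : DataEmbedding D) (x : X') :
    Function.Injective (mfderiv (𝓡 n) (𝓡 (n + 1)) 𝒮.embed x) := fun v₁ v₂ h ↦ by
  by_contra hne
  have hpos := 𝒮.val_mfderiv_embed_pos x (sub_ne_zero.mpr hne)
  rw [map_sub, h, sub_self, map_zero] at hpos
  simp at hpos

/-- The data embedding is differentiable (it is a smooth embedding). Ringström 2009, Def. 16.2.
[cite: Ringstrom2009, Def. 16.2] -/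
theorem mdifferentiable_embed (𝒮 : DataEmbedding D) :
    MDifferentiable (𝓡 n) (𝓡 (n + 1)) 𝒮.embed :=
  𝒮.isSmoothEmbedding.contMDiff.mdifferentiable (by simp)

omit [IsManifold (𝓡 n) ∞ X'] [ConnectedSpace X'] in
/-- The dimension count `dim T_x X + 1 = dim T_{ι x} M` of a hypersurface. [folklore] -/
theorem finrank_tangentSpace_add_one (x : X') :
    finrank ℝ (TangentSpace (𝓡 n) x) + 1 = finrank ℝ (EuclideanSpace ℝ (Fin (n + 1))) := by
  change finrank ℝ (EuclideanSpace ℝ (Fin n)) + 1 = finrank ℝ (EuclideanSpace ℝ (Fin (n + 1)))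
  rw [finrank_euclideanSpace_fin, finrank_euclideanSpace_fin]

/-- **`T_{ι x} M = dι(T_x X) ⊕ ℝ ν`**: every tangent vector at a point of the data hypersurface is
`dι v + a ν` with `a = -g(ν, w)` (`ν` the future unit normal, `g(ν, ν) = -1`), by
`PseudoRiemannianMetric.exists_eq_add_smul_of_normal` (the image of `dι` is the hyperplane
`ν^⊥`). O'Neill 1983, Ch. 2, Lemma 2.23; Wald 1984, §10.2 (the decomposition along the unit
normal `n^a`). [cite: ONeillSemiRiemannian1983, Ch. 2, Lemma 2.23] -/
theorem exists_eq_mfderiv_embed_add_smul_normal (𝒮 : DataEmbedding D) (x : X')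
    (w : TangentSpace (𝓡 (n + 1)) (𝒮.embed x)) :
    ∃ v : TangentSpace (𝓡 n) x, w = mfderiv (𝓡 n) (𝓡 (n + 1)) 𝒮.embed x v +
      (-(𝒮.metric.val (𝒮.embed x) (𝒮.normal x) w)) • 𝒮.normal x := by
  have hνν : 𝒮.metric.val (𝒮.embed x) (𝒮.normal x) (𝒮.normal x) = -1 :=
    𝒮.isFutureUnitNormal.1.2 x
  obtain ⟨v, hv⟩ := 𝒮.metric.toPseudoRiemannianMetric.exists_eq_add_smul_of_normal
    (mfderiv (𝓡 n) (𝓡 (n + 1)) 𝒮.embed x) (𝒮.mfderiv_embed_injective x)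
    (finrank_tangentSpace_add_one x) (𝒮.isFutureUnitNormal.1.1 x) (by rw [hνν]; norm_num) w
  refine ⟨v, ?_⟩
  rw [hνν] at hv
  simpa [div_neg, div_one] using hv

/-- **Chain rule along the data hypersurface**: if `ψ ∘ ι₁ = ι₂` for a differentiable `ψ : M₁ → M₂`,
then `dψ (dι₁ v) = dι₂ v`. This is "since `ψ₁` and `ψ₂` agree on `Σ`, their differentials agree on
`Σ` if evaluated on vectors tangent to `Σ`" (Sbierski 2016, §3.1, proof of the corollary to the
first lemma). [cite: Sbierski2016AHP, §3.1, proof of the corollary to the first lemma] -/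
theorem mfderiv_comp_embed_apply (𝒮₁ 𝒮₂ : DataEmbedding D) {ψ : 𝒮₁.carrier → 𝒮₂.carrier}
    (hψ : MDifferentiable (𝓡 (n + 1)) (𝓡 (n + 1)) ψ) (hψι : ψ ∘ 𝒮₁.embed = 𝒮₂.embed) (x : X')
    (v : TangentSpace (𝓡 n) x) :
    mfderiv (𝓡 (n + 1)) (𝓡 (n + 1)) ψ (𝒮₁.embed x) (mfderiv (𝓡 n) (𝓡 (n + 1)) 𝒮₁.embed x v) =
      mfderiv (𝓡 n) (𝓡 (n + 1)) 𝒮₂.embed x v := by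
  have h := mfderiv_comp x (hψ (𝒮₁.embed x)) (𝒮₁.mdifferentiable_embed x)
  rw [hψι] at h
  exact (congrArg (fun L ↦ L v) h).symm

/-- **An embedding of developments maps the future unit normal to the future unit normal**:
if `ψ : M₁ → M₂` is a time-orientation preserving isometric immersion with `ψ ∘ ι₁ = ι₂`, then
`dψ (ν₁ x) = ν₂ x` for every `x`. Indeed `dψ (ν₁ x)` is of square `-1`, future-directed
(`PreservesTimeOrientation.isFutureDirected_mfderiv`) and normal to `dψ (dι₁ T_x X) = dι₂ (T_x X)`,
and the future unit normal is unique (`TimeOrientation.eq_of_isFutureUnitNormal`). "Since the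
isometric immersions preserve the time orientation, they both map the future normal of `Σ` onto
the future normal of `ψ₁(Σ) = ψ₂(Σ)`" (Sbierski 2016, §3.1, proof of the corollary to the first
lemma). [cite: Sbierski2016AHP, §3.1, proof of the corollary to the first lemma] -/
theorem mfderiv_normal (𝒮₁ 𝒮₂ : DataEmbedding D) {ψ : 𝒮₁.carrier → 𝒮₂.carrier}
    (hψi : 𝒮₁.metric.IsIsometricImmersion 𝒮₂.metric.toPseudoRiemannianMetric ψ)
    (hψτ : 𝒮₁.timeOrientation.PreservesTimeOrientation ψ 𝒮₂.timeOrientation)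
    (hψι : ψ ∘ 𝒮₁.embed = 𝒮₂.embed) (x : X') :
    mfderiv (𝓡 (n + 1)) (𝓡 (n + 1)) ψ (𝒮₁.embed x) (𝒮₁.normal x) = 𝒮₂.normal x := by
  have hψd : MDifferentiable (𝓡 (n + 1)) (𝓡 (n + 1)) ψ := hψi.1.mdifferentiable (by simp)
  have hx : ψ (𝒮₁.embed x) = 𝒮₂.embed x := congrFun hψι x
  have key : ∀ u w : TangentSpace (𝓡 (n + 1)) (𝒮₁.embed x),
      𝒮₂.metric.val (ψ (𝒮₁.embed x)) (mfderiv (𝓡 (n + 1)) (𝓡 (n + 1)) ψ (𝒮₁.embed x) u)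
        (mfderiv (𝓡 (n + 1)) (𝓡 (n + 1)) ψ (𝒮₁.embed x) w) =
      𝒮₁.metric.val (𝒮₁.embed x) u w := fun u w ↦ by
    have h := congrArg (fun b ↦ b u w) (hψi.2 (𝒮₁.embed x))
    simpa only [pullbackBilin_apply] using h
  refine 𝒮₂.timeOrientation.eq_of_isFutureUnitNormal hx.symm (mfderiv (𝓡 n) (𝓡 (n + 1)) 𝒮₂.embed x)
    (fun v hv ↦ 𝒮₂.val_mfderiv_embed_pos x hv) (finrank_tangentSpace_add_one x)
    (𝒮₂.isFutureUnitNormal.1.1 x) (𝒮₂.isFutureUnitNormal.1.2 x) (𝒮₂.isFutureUnitNormal.2 x)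
    (fun v ↦ ?_) ?_ ?_
  · rw [← mfderiv_comp_embed_apply 𝒮₁ 𝒮₂ hψd hψι x v, key]
    exact 𝒮₁.isFutureUnitNormal.1.1 x v
  · rw [key]
    exact 𝒮₁.isFutureUnitNormal.1.2 x
  · exact hψτ.isFutureDirected_mfderiv hψi.2 (𝒮₁.isFutureUnitNormal.2 x)

/-- **The differential of an embedding of developments along the data hypersurface is determined
by the data** (Sbierski 2016, §3.1, proof of the corollary to the first lemma: "Thus, the
differentials of `ψ₁` and `ψ₂` agree on `Σ`"): two time-orientation preserving isometric
immersions `ψ, ψ' : M₁ → M₂` with `ψ ∘ ι₁ = ι₂ = ψ' ∘ ι₁` have the same differential at every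
point `ι₁ x` — both send `dι₁ v ↦ dι₂ v` (`mfderiv_comp_embed_apply`) and `ν₁ ↦ ν₂`
(`mfderiv_normal`), and `T_{ι₁ x} M₁ = dι₁(T_x X) ⊕ ℝ ν₁`
(`exists_eq_mfderiv_embed_add_smul_normal`). [cite: Sbierski2016AHP, §3.1, proof of the corollary to the first lemma] -/
theorem mfderiv_eq_mfderiv_of_comp_embed_eq (𝒮₁ 𝒮₂ : DataEmbedding D)
    {ψ ψ' : 𝒮₁.carrier → 𝒮₂.carrier}
    (hψi : 𝒮₁.metric.IsIsometricImmersion 𝒮₂.metric.toPseudoRiemannianMetric ψ)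
    (hψτ : 𝒮₁.timeOrientation.PreservesTimeOrientation ψ 𝒮₂.timeOrientation)
    (hψι : ψ ∘ 𝒮₁.embed = 𝒮₂.embed)
    (hψ'i : 𝒮₁.metric.IsIsometricImmersion 𝒮₂.metric.toPseudoRiemannianMetric ψ')
    (hψ'τ : 𝒮₁.timeOrientation.PreservesTimeOrientation ψ' 𝒮₂.timeOrientation)
    (hψ'ι : ψ' ∘ 𝒮₁.embed = 𝒮₂.embed) (x : X') (w : TangentSpace (𝓡 (n + 1)) (𝒮₁.embed x)) :
    mfderiv (𝓡 (n + 1)) (𝓡 (n + 1)) ψ (𝒮₁.embed x) w =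
      mfderiv (𝓡 (n + 1)) (𝓡 (n + 1)) ψ' (𝒮₁.embed x) w := by
  have hψd : MDifferentiable (𝓡 (n + 1)) (𝓡 (n + 1)) ψ := hψi.1.mdifferentiable (by simp)
  have hψ'd : MDifferentiable (𝓡 (n + 1)) (𝓡 (n + 1)) ψ' := hψ'i.1.mdifferentiable (by simp)
  obtain ⟨v, hw⟩ := 𝒮₁.exists_eq_mfderiv_embed_add_smul_normal x w
  rw [hw, map_add, map_smul, map_add, map_smul, mfderiv_comp_embed_apply 𝒮₁ 𝒮₂ hψd hψι,
    mfderiv_comp_embed_apply 𝒮₁ 𝒮₂ hψ'd hψ'ι, mfderiv_normal 𝒮₁ 𝒮₂ hψi hψτ hψι,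
    mfderiv_normal 𝒮₁ 𝒮₂ hψ'i hψ'τ hψ'ι]
  rfl

/-- The identity is a time-orientation preserving isometric immersion commuting with the data
embedding (the witnesses of `EmbedsInto.refl`). Ringström 2009, Def. 16.5.
[cite: Ringstrom2009, Def. 16.5] -/
theorem isIsometricImmersion_id (𝒮 : DataEmbedding D) :
    𝒮.metric.IsIsometricImmersion 𝒮.metric.toPseudoRiemannianMetric id ∧
      𝒮.timeOrientation.PreservesTimeOrientation id 𝒮.timeOrientation ∧ id ∘ 𝒮.embed = 𝒮.embed := by
  refine ⟨⟨contMDiff_id, fun y ↦ ?_⟩, fun y ↦ ?_, rfl⟩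
  · rw [pullbackBilin_id]
  · rw [mfderiv_id]
    exact 𝒮.timeOrientation.isFutureDirected_vectorField y

/-- **A self-embedding of a development fixing the data has identity one-jet along the data
hypersurface**: if `φ : M → M` is a time-orientation preserving isometric immersion with
`φ ∘ ι = ι`, then `φ (ι x) = ι x` and `dφ_{ι x} = id` (the case `ψ = φ`, `ψ' = id` of
`mfderiv_eq_mfderiv_of_comp_embed_eq`). This is step (2) of the uniqueness argument recorded in
the module docstring of `CauchyProblemCauchy` (Choquet-Bruhat–Geroch 1969, proof of Thm. 3,
p. 332; Sbierski 2016, §3.1). [cite: ChoquetBruhatGeroch1969CMP, Thm. 3, proof (p. 332)] -/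
theorem mfderiv_apply_eq_self_of_comp_embed_eq (𝒮 : DataEmbedding D) {φ : 𝒮.carrier → 𝒮.carrier}
    (hφi : 𝒮.metric.IsIsometricImmersion 𝒮.metric.toPseudoRiemannianMetric φ)
    (hφτ : 𝒮.timeOrientation.PreservesTimeOrientation φ 𝒮.timeOrientation)
    (hφι : φ ∘ 𝒮.embed = 𝒮.embed) (x : X') (w : TangentSpace (𝓡 (n + 1)) (𝒮.embed x)) :
    mfderiv (𝓡 (n + 1)) (𝓡 (n + 1)) φ (𝒮.embed x) w = w := by
  obtain ⟨hi, hτ, hι⟩ := 𝒮.isIsometricImmersion_id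
  have h := mfderiv_eq_mfderiv_of_comp_embed_eq 𝒮 𝒮 hφi hφτ hφι hi hτ hι x w
  rwa [mfderiv_id] at h

/-! ### Rigidity of developments from one-jet rigidity of local isometries -/

/-- **Rigidity of a data embedding, from O'Neill's one-jet rigidity of its spacetime.** Suppose
the spacetime `(M, g)` of `𝒮` has the property that an isometric immersion `φ : M → M` with a
fixed point at which its differential is the identity is the identity map — O'Neill 1983, Ch. 3,
Prop. 3.62 ("an isometry, indeed a local isometry of a connected manifold, is determined by its
differential at a single point": `φ ∘ exp_p = exp_p ∘ dφ_p` and an open–closed argument);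
Sbierski 2016, §3.1, first lemma. Then every time-orientation preserving isometric immersion
`φ : M → M` with `φ ∘ ι = ι` is the identity: `X` is nonempty (connected), and at `p = ι x` we
have `φ p = p` and `dφ_p = id` (`mfderiv_apply_eq_self_of_comp_embed_eq`). This discharges the
rigidity hypothesis `hrig` of `DataEmbedding.isIsometricTo_of_embedsInto` /
`VacuumCauchyDevelopment.isIsometricTo_of_isMaximal` from the one-jet statement `hjet` about
`(M, g)` alone. [cite: ONeillSemiRiemannian1983, Ch. 3, Prop. 3.62] -/
theorem eq_id_of_comp_embed_eq (𝒮 : DataEmbedding D)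
    (hjet : ∀ φ : 𝒮.carrier → 𝒮.carrier,
      𝒮.metric.IsIsometricImmersion 𝒮.metric.toPseudoRiemannianMetric φ →
        ∀ p : 𝒮.carrier, φ p = p →
          (∀ w : TangentSpace (𝓡 (n + 1)) p, mfderiv (𝓡 (n + 1)) (𝓡 (n + 1)) φ p w = w) →
            φ = id)
    {φ : 𝒮.carrier → 𝒮.carrier}
    (hφi : 𝒮.metric.IsIsometricImmersion 𝒮.metric.toPseudoRiemannianMetric φ)
    (hφτ : 𝒮.timeOrientation.PreservesTimeOrientation φ 𝒮.timeOrientation)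
    (hφι : φ ∘ 𝒮.embed = 𝒮.embed) : φ = id := by
  obtain ⟨x⟩ : Nonempty X' := inferInstance
  exact hjet φ hφi (𝒮.embed x) (congrFun hφι x)
    (𝒮.mfderiv_apply_eq_self_of_comp_embed_eq hφi hφτ hφι x)

/-- **Mutual embeddings of data embeddings are isometries, given one-jet rigidity** (the form of
`DataEmbedding.isIsometricTo_of_embedsInto` with its rigidity hypothesis discharged down to
O'Neill 1983, Ch. 3, Prop. 3.62 for the first spacetime). Choquet-Bruhat–Geroch 1969, p. 334
("The uniqueness of M follows immediately from the uniqueness of (U, ψ)").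
[cite: ChoquetBruhatGeroch1969CMP, Thm. 3, proof (p. 334)] -/
theorem isIsometricTo_of_embedsInto_of_oneJet {𝒮₁ 𝒮₂ : DataEmbedding D}
    (hjet : ∀ φ : 𝒮₁.carrier → 𝒮₁.carrier,
      𝒮₁.metric.IsIsometricImmersion 𝒮₁.metric.toPseudoRiemannianMetric φ →
        ∀ p : 𝒮₁.carrier, φ p = p →
          (∀ w : TangentSpace (𝓡 (n + 1)) p, mfderiv (𝓡 (n + 1)) (𝓡 (n + 1)) φ p w = w) →
            φ = id)
    (h₁₂ : 𝒮₁.EmbedsInto 𝒮₂) (h₂₁ : 𝒮₂.EmbedsInto 𝒮₁) : 𝒮₁.IsIsometricTo 𝒮₂ :=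
  isIsometricTo_of_embedsInto (fun _ hφi hφτ hφι ↦ 𝒮₁.eq_id_of_comp_embed_eq hjet hφi hφτ hφι)
    h₁₂ h₂₁

end DataEmbedding

/-- **Uniqueness of the maximal vacuum Cauchy development up to isometry, reduced to one-jet
rigidity of local isometries** (Choquet-Bruhat–Geroch, Comm. Math. Phys. 14 (1969), Thm. 3,
p. 332: "This development is unique (up to isometry)"; Ringström 2009, Thm. 16.6; Sbierski 2016,
Theorem "Existence of MGHD": "The GHD `M̃` is unique up to isometry"). Let `𝒟₁, 𝒟₂` be maximal
vacuum Cauchy developments of the same data, and suppose the spacetime of `𝒟₁` satisfies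
O'Neill's Prop. 3.62 in the form `hjet` (an isometric immersion `M₁ → M₁` fixing a point to
first order is the identity — the first lemma of Sbierski 2016, §3.1, whose exponential-map
proof is the one ingredient not yet carried by the tree). Then `𝒟₁` and `𝒟₂` are isometric as
developments: they embed into each other by maximality, the composite self-embedding of `𝒟₁`
fixes `ι₁(X)` pointwise, hence has identity one-jet there
(`DataEmbedding.mfderiv_apply_eq_self_of_comp_embed_eq`: tangential part by the chain rule,
normal part by uniqueness of the future unit normal), hence is the identity by `hjet`, and
`DataEmbedding.isIsometricTo_of_embedsInto` concludes. Compared with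
`VacuumCauchyDevelopment.isIsometricTo_of_isMaximal` (`CauchyProblemCauchy`) the hypothesis no
longer mentions the data, the embedding or the time orientation.
[cite: ChoquetBruhatGeroch1969CMP, Thm. 3 (pp. 332–334)] -/
theorem VacuumCauchyDevelopment.isIsometricTo_of_isMaximal_of_oneJet
    {𝒟₁ 𝒟₂ : VacuumCauchyDevelopment D}
    (hjet : ∀ φ : 𝒟₁.carrier → 𝒟₁.carrier,
      𝒟₁.metric.IsIsometricImmersion 𝒟₁.metric.toPseudoRiemannianMetric φ →
        ∀ p : 𝒟₁.carrier, φ p = p →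
          (∀ w : TangentSpace (𝓡 (n + 1)) p, mfderiv (𝓡 (n + 1)) (𝓡 (n + 1)) φ p w = w) →
            φ = id)
    (h₁ : 𝒟₁.IsMaximal) (h₂ : 𝒟₂.IsMaximal) :
    𝒟₁.toCauchyDevelopment.IsIsometricTo 𝒟₂.toCauchyDevelopment :=
  DataEmbedding.isIsometricTo_of_embedsInto_of_oneJet hjet (h₂ 𝒟₁) (h₁ 𝒟₂)

/-- **An extension of a maximal vacuum Cauchy development is isometric to it, given one-jet
rigidity** (`IsMaximal.isIsometricTo_of_embedsInto` of `CauchyDevelopmentIsometryClasses` with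
rigidity discharged down to `hjet`; an extension of a maximal development is maximal, since
embeddings compose): the MGHD is inextendible within the globally hyperbolic vacuum
developments. Choquet-Bruhat–Geroch 1969, Thm. 3; Sbierski 2016, end of §3.3.
[cite: ChoquetBruhatGeroch1969CMP, Thm. 3 (pp. 332–334)] -/
theorem VacuumCauchyDevelopment.IsMaximal.isIsometricTo_of_embedsInto_of_oneJet
    {𝒟₁ 𝒟₂ : VacuumCauchyDevelopment D}
    (hjet : ∀ φ : 𝒟₁.carrier → 𝒟₁.carrier,
      𝒟₁.metric.IsIsometricImmersion 𝒟₁.metric.toPseudoRiemannianMetric φ →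
        ∀ p : 𝒟₁.carrier, φ p = p →
          (∀ w : TangentSpace (𝓡 (n + 1)) p, mfderiv (𝓡 (n + 1)) (𝓡 (n + 1)) φ p w = w) →
            φ = id)
    (h₁ : 𝒟₁.IsMaximal) (h₁₂ : 𝒟₁.toCauchyDevelopment.EmbedsInto 𝒟₂.toCauchyDevelopment) :
    𝒟₁.toCauchyDevelopment.IsIsometricTo 𝒟₂.toCauchyDevelopment :=
  isIsometricTo_of_isMaximal_of_oneJet hjet h₁ fun 𝒟 ↦ (h₁ 𝒟).trans h₁₂

end DataEmbedding

end Literature.Geometry.Lorentzian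

end
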